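import Mathlib
import Summits.Parity.GeneralizedHardyLittlewood.Theorems.LiouvilleMADCosetDecorrelationStubNormalForm
import Literature.NumberTheory.QuadraticFields.BakerLimitFormulaCharSums

/-!
# The real-character obstruction for the coset sums of the crux `CosetDecorrelation`

Stub `stub_characterPretender` of line `SketchIdeator3` of crux stmt-Parity-13317
(`Summit.Parity.GeneralizedHardyLittlewood.Theses.LiouvilleMAD.CosetDecorrelation`; cards
`farey-level-mean-coupling` "Disproof used (a)", `gram-split-farey-phase` B2, IdeatorMemo3 F2).
Sources: Jacobsthal sums via the tree
(`Literature.NumberTheory.QuadraticFields.BakerLimitFormula.sum_quadraticChar_bqf`, the line sum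
`Σ_x χ_p(x² + tx − m) = −1` for `p ∤ t² + 4m`), the class-fibration identities of the landed stub
file `…StubNormalForm` (`normalForm_coset_eq_classInner`, `normalForm_sum_classSum`), Mathlib
(`Nat.Ioc_filter_modEq_card`, `quadraticChar_sum_zero`) otherwise.

**What is proved.**  Let `p` be an odd prime, `χ = χ_p` the quadratic character of `ZMod p`,
`c ∈ ℤ` with `p ∤ c`, `j ≥ 1` a modulus with `p ∣ j`, and `n, n'` naturals with `p ∤ n n' (n − n')`.
On the dyadic block `I = (M, 2M]` put `u(m) = χ(mn + c)`, `v(m) = χ(mn' + c)`,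
`T = Σ_{(m,m') ∈ I², m ≡ m' (mod j)} u(m) v(m')`, `S = Σ_I u`, `S' = Σ_I v`.  Then
`M²/(jp) − 2M − 2j ≤ |T − S S'/j|`: the mean-corrected coset sum of the crux, with the Liouville
function replaced by a quadratic pretender whose conductor divides `j`, has size `≫ M^{3/2}/p`, so
the residual stub K1 (`≤ C M^{3/4+ϑ}`, `ϑ < 1/4`) and the crux itself FAIL for every such pretender.

**Proof.**
1. (classes) `T = Σ_{a<j} A(a) B(a)`, `S = Σ_{a<j} A(a)` with the class sums
   `A(a) = Σ_{m ∈ I, m ≡ a (j)} u(m)` (`normalForm_coset_eq_classInner`, `normalForm_sum_classSum`);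
   as `p ∣ j`, `u` is constant on classes: `A(a) = c_a χ(an + c)`, `B(a) = c_a χ(an' + c)`,
   `c_a = #{m ∈ I : m ≡ a (j)}`.
2. (class sizes) `|c_a − M/j| ≤ 1` (`Nat.Ioc_filter_modEq_card`: a difference of two floors).
3. (complete sums) `range j` consists of `j/p` full periods, so
   `Σ_{a<j} χ(an+c) = (j/p) Σ_{x mod p} χ(xn+c) = 0` and
   `Σ_{a<j} χ(an+c) χ(an'+c) = (j/p) Σ_x χ((xn+c)(xn'+c)) = −(j/p) χ(nn')` (Jacobsthal:
   `(xn+c)(xn'+c) = nn'·(x² + (α+β)x + αβ)`, `α = c/n ≠ β = c/n'`, discriminant `(α − β)² ≠ 0`).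
4. (assembly) with `c_a = M/j + δ_a`, `|δ_a| ≤ 1`: `S = Σ_a δ_a χ`, so `|S|, |S'| ≤ j`, and
   `T = (M/j)² Σ_a χχ' + Σ_a δ_a (2M/j + δ_a) χχ'`, so `|T| ≥ (M/j)²(j/p) − (2M + j)` and
   `|T − SS'/j| ≥ |T| − j ≥ M²/(jp) − 2M − 2j`.
Steps 1, 2, 4 are carried out for general bounded `p`-periodic weights (`pretender_abstract`).
-/

namespace Summit.Parity.GeneralizedHardyLittlewood.Theorems.CosetDecorrelation.FareyLevelMeanCoupling

open Finset

/-- Difference of floors: for `y ≤ x`, `max (⌊x⌋ − ⌊y⌋) 0` is within `1` of `x − y`. [folklore] -/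
theorem pretender_floor_sub_floor (x y : ℚ) (hxy : y ≤ x) :
    |((max (⌊x⌋ - ⌊y⌋) 0 : ℤ) : ℚ) - (x - y)| ≤ 1 := by
  have h1 := Int.floor_le x
  have h2 := Int.lt_floor_add_one x
  have h3 := Int.floor_le y
  have h4 := Int.lt_floor_add_one y
  have h0 : (0 : ℤ) ≤ ⌊x⌋ - ⌊y⌋ := sub_nonneg.mpr (Int.floor_le_floor hxy)
  rw [max_eq_left h0, abs_le]
  push_cast
  constructor <;> linarith

/-- Class sizes: the number of `m ∈ (M, 2M]` in a fixed class modulo `j ≥ 1` is within `1` of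
`M/j` (`Nat.Ioc_filter_modEq_card`). [folklore] -/
theorem pretender_classSize (M a : ℕ) {j : ℕ} (hj : 0 < j) :
    |((#((Ioc M (2 * M)).filter (fun m => m ≡ a [MOD j])) : ℕ) : ℝ) - (M : ℝ) / j| ≤ 1 := by
  have h := Nat.Ioc_filter_modEq_card M (2 * M) hj a
  have hxy : ((M : ℕ) - a : ℚ) / j ≤ ((2 * M : ℕ) - a : ℚ) / j :=
    div_le_div_of_nonneg_right (by push_cast; linarith [(Nat.cast_nonneg M : (0 : ℚ) ≤ M)])
      (by positivity)
  have key := pretender_floor_sub_floor _ _ hxy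
  rw [← h, Int.cast_natCast] at key
  have e : (((2 * M : ℕ) : ℚ) - a) / j - (((M : ℕ) : ℚ) - a) / j = (M : ℚ) / j := by
    push_cast; ring
  rw [e] at key
  have key' := (Rat.cast_le (K := ℝ)).mpr key
  push_cast at key'
  exact key'

/-- A sum over `0 ≤ a < p` of a function of `a mod p` is the sum over `ZMod p`. [folklore] -/
theorem pretender_sum_range_eq_univ {p : ℕ} [NeZero p] (H : ZMod p → ℝ) :
    ∑ a ∈ range p, H (a : ZMod p) = ∑ x, H x := by
  refine sum_nbij' (fun b : ℕ => (b : ZMod p)) (fun x => x.val) (by simp)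
    (fun x _ => mem_range.2 (ZMod.val_lt x)) (fun b hb => ?_) (fun x _ => ?_) (fun _ _ => rfl)
  · exact ZMod.val_cast_of_lt (mem_range.1 hb)
  · exact ZMod.natCast_zmod_val x

/-- `k` full periods: `Σ_{a < pk} H(a mod p) = k · Σ_{x mod p} H(x)`. [folklore] -/
theorem pretender_sum_range_mul {p : ℕ} [NeZero p] (H : ZMod p → ℝ) (k : ℕ) :
    ∑ a ∈ range (p * k), H (a : ZMod p) = k * ∑ x, H x := by
  induction k with
  | zero => simp
  | succ k ih =>
    rw [Nat.mul_succ, sum_range_add, ih, Nat.cast_succ, add_mul, one_mul,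
      ← pretender_sum_range_eq_univ H]
    congr 1
    refine sum_congr rfl fun x _ => ?_
    rw [Nat.cast_add, Nat.cast_mul, ZMod.natCast_self, zero_mul, zero_add]

/-- **Jacobsthal.**  For an odd prime `p` and `n, n', c ∈ (ZMod p)ˣ` with `n ≠ n'`:
`Σ_{x mod p} χ_p((xn + c)(xn' + c)) = −χ_p(n n')`.  Factor `nn'`:
`(xn + c)(xn' + c) = nn' · (x² + (α+β)x + αβ)` with `α = c/n ≠ β = c/n'`, discriminant
`(α − β)² ≠ 0`, and the tree's line sum `Σ_x χ_p(x² + tx − m) = −1`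
(`BakerLimitFormula.sum_quadraticChar_bqf` at `y = 1`). [folklore] -/
theorem pretender_jacobsthal {p : ℕ} [Fact p.Prime] (hp2 : p ≠ 2) {n n' c : ZMod p}
    (hn : n ≠ 0) (hn' : n' ≠ 0) (hc : c ≠ 0) (hne : n ≠ n') :
    ∑ x : ZMod p, quadraticChar (ZMod p) ((x * n + c) * (x * n' + c))
      = -quadraticChar (ZMod p) (n * n') := by
  have hαβ : c / n ≠ c / n' := fun h =>
    hne (mul_left_cancel₀ hc ((div_eq_div_iff hn hn').mp h)).symm
  have hD : (c / n + c / n') ^ 2 + 4 * (-(c / n * (c / n'))) ≠ 0 := by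
    rw [show (c / n + c / n') ^ 2 + 4 * (-(c / n * (c / n'))) = (c / n - c / n') ^ 2 by ring]
    exact pow_ne_zero 2 (sub_ne_zero.mpr hαβ)
  have key : ∀ x : ZMod p, (x * n + c) * (x * n' + c)
      = (n * n') * (x ^ 2 + (c / n + c / n') * x * 1 - (-(c / n * (c / n'))) * 1 ^ 2) := by
    intro x
    field_simp
    ring
  have hsum : ∑ x : ZMod p, quadraticChar (ZMod p) ((x * n + c) * (x * n' + c))
      = ∑ x : ZMod p, quadraticChar (ZMod p) (n * n') *
          quadraticChar (ZMod p) (x ^ 2 + (c / n + c / n') * x * 1 - (-(c / n * (c / n'))) * 1 ^ 2) :=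
    sum_congr rfl fun x _ => by rw [key x, map_mul]
  rw [hsum, ← mul_sum,
    Literature.NumberTheory.QuadraticFields.BakerLimitFormula.sum_quadraticChar_bqf hp2 hD 1,
    if_neg one_ne_zero, mul_neg, mul_one]

/-- **Abstract obstruction** (steps 1, 2, 4 of the module docstring, general weights): if
`f(m) = F(m mod p)`, `g(m) = G(m mod p)` with `|F|, |G| ≤ 1`, `Σ_{x mod p} F = Σ_{x mod p} G = 0`
and `|Σ_{x mod p} F G| = 1`, then for every `M` and every modulus `j ≥ 1` with `p ∣ j` the
mean-corrected coset sum on `(M, 2M]` satisfies `M²/(jp) − 2M − 2j ≤ |T − S S'/j|`. [folklore] -/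
theorem pretender_abstract {p : ℕ} [NeZero p] (F G : ZMod p → ℝ) (f g : ℕ → ℝ)
    (hfF : ∀ m, f m = F (m : ZMod p)) (hgG : ∀ m, g m = G (m : ZMod p))
    (hF1 : ∀ x, |F x| ≤ 1) (hG1 : ∀ x, |G x| ≤ 1)
    (hF0 : ∑ x, F x = 0) (hG0 : ∑ x, G x = 0) (hFG : |∑ x, F x * G x| = 1)
    (M j : ℕ) (hj : 1 ≤ j) (hpj : p ∣ j) :
    (M : ℝ) ^ 2 / ((j : ℝ) * (p : ℝ)) - 2 * (M : ℝ) - 2 * (j : ℝ) ≤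
      |(∑ q ∈ (Finset.Ioc M (2 * M) ×ˢ Finset.Ioc M (2 * M)).filter
            (fun q : ℕ × ℕ => q.1 ≡ q.2 [MOD j]), f q.1 * g q.2)
        - (∑ m ∈ Finset.Ioc M (2 * M), f m) * (∑ m ∈ Finset.Ioc M (2 * M), g m) / (j : ℝ)| := by
  obtain ⟨k, rfl⟩ := hpj
  have hJpos : (0 : ℝ) < ((p * k : ℕ) : ℝ) := by exact_mod_cast hj
  have hJne : ((p * k : ℕ) : ℝ) ≠ 0 := hJpos.ne'
  have hp0 : (p : ℝ) ≠ 0 := by exact_mod_cast NeZero.ne p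
  have hk0 : (k : ℝ) ≠ 0 := by
    have : k ≠ 0 := by rintro rfl; simp at hj
    exact_mod_cast this
  rw [normalForm_coset_eq_classInner f g M (p * k) hj, ← normalForm_sum_classSum f M (p * k) hj,
    ← normalForm_sum_classSum g M (p * k) hj]
  -- Step 1: the class sums are `c_a · F(a)`, `c_a · G(a)`
  set cnt : ℕ → ℝ := fun a => ((#((Ioc M (2 * M)).filter (fun m => m ≡ a [MOD p * k])) : ℕ) : ℝ)
    with hcnt
  have hcls : ∀ (h : ℕ → ℝ) (H : ZMod p → ℝ), (∀ m, h m = H (m : ZMod p)) → ∀ a,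
      ∑ m ∈ (Ioc M (2 * M)).filter (fun m => m ≡ a [MOD p * k]), h m = cnt a * H (a : ZMod p) := by
    intro h H hhH a
    rw [sum_congr rfl fun m hm => ?_, sum_const, nsmul_eq_mul]
    rw [hhH, (ZMod.natCast_eq_natCast_iff _ _ _).mpr
      (((mem_filter.mp hm).2).of_dvd (dvd_mul_right p k))]
  simp only [hcls f F hfF, hcls g G hgG]
  -- Step 2: class sizes `c_a = M/j + δ_a`, `|δ_a| ≤ 1`
  set δ : ℕ → ℝ := fun a => cnt a - (M : ℝ) / ((p * k : ℕ) : ℝ) with hδ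
  have hδ1 : ∀ a, |δ a| ≤ 1 := fun a => pretender_classSize M a hj
  -- Steps 3/4a: the means are `O(j)` (the complete sums of `F`, `G` vanish)
  have hS : ∀ H : ZMod p → ℝ, ∑ x, H x = 0 → (∀ x, |H x| ≤ 1) →
      |∑ a ∈ range (p * k), cnt a * H a| ≤ ((p * k : ℕ) : ℝ) := by
    intro H hH0 hH1
    have hper : ∑ a ∈ range (p * k), H (a : ZMod p) = 0 := by
      rw [pretender_sum_range_mul H k, hH0, mul_zero]
    have e : ∑ a ∈ range (p * k), cnt a * H a = ∑ a ∈ range (p * k), δ a * H a := by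
      rw [← add_zero (∑ a ∈ range (p * k), δ a * H a),
        ← mul_zero ((M : ℝ) / ((p * k : ℕ) : ℝ)), ← hper, mul_sum, ← sum_add_distrib]
      exact sum_congr rfl fun a _ => by simp only [hδ]; ring
    rw [e]
    calc |∑ a ∈ range (p * k), δ a * H a|
        ≤ ∑ a ∈ range (p * k), |δ a * H a| := abs_sum_le_sum_abs _ _
      _ ≤ ∑ a ∈ range (p * k), (1 : ℝ) := sum_le_sum fun a _ => by
          rw [abs_mul]
          exact (mul_le_mul (hδ1 a) (hH1 _) (abs_nonneg _) zero_le_one).trans_eq (one_mul 1)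
      _ = ((p * k : ℕ) : ℝ) := by rw [sum_const, card_range, nsmul_eq_mul, mul_one]
  -- Steps 3/4b: the main term `Σ_a c_a² F(a) G(a)`
  have hT : (M : ℝ) ^ 2 / (((p * k : ℕ) : ℝ) * (p : ℝ)) - 2 * (M : ℝ) - ((p * k : ℕ) : ℝ)
      ≤ |∑ a ∈ range (p * k), cnt a * F a * (cnt a * G a)| := by
    have hper : ∑ a ∈ range (p * k), F a * G a = k * ∑ x, F x * G x :=
      pretender_sum_range_mul (fun x => F x * G x) k
    have e : ∑ a ∈ range (p * k), cnt a * F a * (cnt a * G a)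
        = ((M : ℝ) / ((p * k : ℕ) : ℝ)) ^ 2 * ∑ a ∈ range (p * k), F a * G a
          + ∑ a ∈ range (p * k), δ a * (2 * (M : ℝ) / ((p * k : ℕ) : ℝ) + δ a) * (F a * G a) := by
      rw [mul_sum, ← sum_add_distrib]
      exact sum_congr rfl fun a _ => by simp only [hδ]; ring
    have hmain : |((M : ℝ) / ((p * k : ℕ) : ℝ)) ^ 2 * ∑ a ∈ range (p * k), F a * G a|
        = (M : ℝ) ^ 2 / (((p * k : ℕ) : ℝ) * (p : ℝ)) := by
      rw [abs_mul, hper, abs_mul, hFG, mul_one, Nat.abs_cast, abs_of_nonneg (sq_nonneg _)]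
      push_cast
      field_simp
    have herr : |∑ a ∈ range (p * k), δ a * (2 * (M : ℝ) / ((p * k : ℕ) : ℝ) + δ a) * (F a * G a)|
        ≤ 2 * (M : ℝ) + ((p * k : ℕ) : ℝ) := by
      have hMJ : (0 : ℝ) ≤ 2 * (M : ℝ) / ((p * k : ℕ) : ℝ) := by positivity
      calc |∑ a ∈ range (p * k), δ a * (2 * (M : ℝ) / ((p * k : ℕ) : ℝ) + δ a) * (F a * G a)|
          ≤ ∑ a ∈ range (p * k), |δ a * (2 * (M : ℝ) / ((p * k : ℕ) : ℝ) + δ a) * (F a * G a)| :=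
            abs_sum_le_sum_abs _ _
        _ ≤ ∑ a ∈ range (p * k), (2 * (M : ℝ) / ((p * k : ℕ) : ℝ) + 1) := sum_le_sum fun a _ => by
            have h1 := hδ1 a
            have h2 := hF1 (a : ZMod p)
            have h3 := hG1 (a : ZMod p)
            have h4 : |2 * (M : ℝ) / ((p * k : ℕ) : ℝ) + δ a| ≤ 2 * (M : ℝ) / ((p * k : ℕ) : ℝ) + 1 := by
              rw [abs_le] at h1 ⊢
              constructor <;> linarith [h1.1, h1.2]
            rw [abs_mul, abs_mul, abs_mul]
            calc |δ a| * |2 * (M : ℝ) / ((p * k : ℕ) : ℝ) + δ a| * (|F a| * |G a|)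
                ≤ 1 * (2 * (M : ℝ) / ((p * k : ℕ) : ℝ) + 1) * (1 * 1) := by gcongr
              _ = _ := by ring
        _ = 2 * (M : ℝ) + ((p * k : ℕ) : ℝ) := by
            rw [sum_const, card_range, nsmul_eq_mul]
            field_simp
    rw [e]
    have h := abs_sub_abs_le_abs_sub
      (((M : ℝ) / ((p * k : ℕ) : ℝ)) ^ 2 * ∑ a ∈ range (p * k), F a * G a)
      (-(∑ a ∈ range (p * k), δ a * (2 * (M : ℝ) / ((p * k : ℕ) : ℝ) + δ a) * (F a * G a)))
    rw [abs_neg, sub_neg_eq_add] at h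
    linarith [hmain, herr, h]
  -- Step 4c: `|S S'/j| ≤ j` and the triangle inequality
  have hSS : |(∑ a ∈ range (p * k), cnt a * F a) * (∑ a ∈ range (p * k), cnt a * G a)
      / ((p * k : ℕ) : ℝ)| ≤ ((p * k : ℕ) : ℝ) := by
    rw [abs_div, abs_mul, Nat.abs_cast, div_le_iff₀ hJpos]
    exact mul_le_mul (hS F hF0 hF1) (hS G hG0 hG1) (abs_nonneg _) (Nat.cast_nonneg _)
  calc (M : ℝ) ^ 2 / (((p * k : ℕ) : ℝ) * (p : ℝ)) - 2 * (M : ℝ) - 2 * ((p * k : ℕ) : ℝ)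
      ≤ |∑ a ∈ range (p * k), cnt a * F a * (cnt a * G a)|
        - |(∑ a ∈ range (p * k), cnt a * F a) * (∑ a ∈ range (p * k), cnt a * G a)
            / ((p * k : ℕ) : ℝ)| := by linarith
    _ ≤ _ := abs_sub_abs_le_abs_sub _ _

/-- **STUB P9 · `stub_characterPretender`** (THE REAL-CHARACTER OBSTRUCTION): for an odd prime `p`,
`c` with `p ∤ c`, a modulus `j ≥ 1` with `p ∣ j`, and `n, n'` with `p ∤ n`, `p ∤ n'`, `p ∤ n − n'`,
the crux's mean-corrected coset sum with `λ` replaced by the quadratic character `χ_p` satisfies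
`M²/(jp) − 2M − 2j ≤ |Σ_{(m,m') ∈ (M,2M]², m ≡ m' (j)} χ_p(mn+c) χ_p(m'n'+c) − S S'/j|`,
`S = Σ_{m ∈ (M,2M]} χ_p(mn+c)`, `S' = Σ_{m ∈ (M,2M]} χ_p(mn'+c)` (`≍ M^{3/2}/p` on the crux's range
`j ≍ √M`): K1 and the crux fail for every quadratic pretender with conductor dividing `j`.
Proof: `pretender_abstract` with `F(x) = χ_p(xn + c)`, `G(x) = χ_p(xn' + c)`; the complete sums
vanish (`quadraticChar_sum_zero` after the affine reindexing `x ↦ xn + c`) and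
`|Σ_x F G| = |−χ_p(nn')| = 1` (`pretender_jacobsthal`). [folklore] -/
theorem stub_characterPretender :
    ∀ (p : ℕ) [Fact p.Prime], p ≠ 2 → ∀ (c : ℤ), ¬ ((p : ℤ) ∣ c) →
      ∀ (M n n' j : ℕ), 1 ≤ j → p ∣ j → ¬ (p ∣ n) → ¬ (p ∣ n') → ¬ ((p : ℤ) ∣ ((n : ℤ) - (n' : ℤ))) →
        (M : ℝ) ^ 2 / ((j : ℝ) * (p : ℝ)) - 2 * (M : ℝ) - 2 * (j : ℝ) ≤
          |(∑ q ∈ (Finset.Ioc M (2 * M) ×ˢ Finset.Ioc M (2 * M)).filter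
                (fun q : ℕ × ℕ => q.1 ≡ q.2 [MOD j]),
              ((quadraticChar (ZMod p) ((((q.1 : ℤ) * n + c : ℤ)) : ZMod p) : ℤ) : ℝ) *
                ((quadraticChar (ZMod p) ((((q.2 : ℤ) * n' + c : ℤ)) : ZMod p) : ℤ) : ℝ))
            - (∑ m ∈ Finset.Ioc M (2 * M),
                  ((quadraticChar (ZMod p) ((((m : ℤ) * n + c : ℤ)) : ZMod p) : ℤ) : ℝ)) *
                (∑ m ∈ Finset.Ioc M (2 * M),
                  ((quadraticChar (ZMod p) ((((m : ℤ) * n' + c : ℤ)) : ZMod p) : ℤ) : ℝ)) / (j : ℝ)| := by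
  intro p hp hp2 c hc M n n' j hj hpj hn hn' hnn'
  have hF : ringChar (ZMod p) ≠ 2 := by rwa [ZMod.ringChar_zmod_n]
  have hn0 : (n : ZMod p) ≠ 0 := by rwa [Ne, ZMod.natCast_eq_zero_iff]
  have hn0' : (n' : ZMod p) ≠ 0 := by rwa [Ne, ZMod.natCast_eq_zero_iff]
  have hc0 : (c : ZMod p) ≠ 0 := by rwa [Ne, ZMod.intCast_zmod_eq_zero_iff_dvd]
  have hne : (n : ZMod p) ≠ (n' : ZMod p) := fun h =>
    hnn' ((ZMod.intCast_eq_intCast_iff_dvd_sub (n' : ℤ) (n : ℤ) p).mp (by exact_mod_cast h.symm))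
  -- character values lie in `{0, ±1}`
  have hχ1 : ∀ x : ZMod p, |((quadraticChar (ZMod p) x : ℤ) : ℝ)| ≤ 1 := fun x => by
    rcases quadraticChar_isQuadratic (ZMod p) x with h | h | h <;> simp [h]
  -- complete sums along a non-constant affine map vanish
  have hχ0 : ∀ u : ZMod p, u ≠ 0 →
      ∑ x : ZMod p, ((quadraticChar (ZMod p) (x * u + c) : ℤ) : ℝ) = 0 := by
    intro u hu
    have h0 : ∑ x : ZMod p, quadraticChar (ZMod p) (x * u + c) = 0 := by
      rw [← quadraticChar_sum_zero hF]
      exact Fintype.sum_equiv ((Equiv.mulRight₀ u hu).trans (Equiv.addRight (c : ZMod p))) _ _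
        fun x => rfl
    exact_mod_cast h0
  -- Jacobsthal
  have hJ : |∑ x : ZMod p, ((quadraticChar (ZMod p) (x * n + c) : ℤ) : ℝ) *
      ((quadraticChar (ZMod p) (x * n' + c) : ℤ) : ℝ)| = 1 := by
    have h := pretender_jacobsthal hp2 hn0 hn0' hc0 hne
    have h' : ∑ x : ZMod p, ((quadraticChar (ZMod p) (x * n + c) : ℤ) : ℝ) *
        ((quadraticChar (ZMod p) (x * n' + c) : ℤ) : ℝ)
        = -((quadraticChar (ZMod p) ((n : ZMod p) * n') : ℤ) : ℝ) := by
      simp only [← Int.cast_mul, ← map_mul]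
      exact_mod_cast h
    rw [h', abs_neg]
    rcases quadraticChar_dichotomy (mul_ne_zero hn0 hn0') with h1 | h1 <;> simp [h1]
  exact pretender_abstract (p := p)
    (fun x : ZMod p => ((quadraticChar (ZMod p) (x * n + c) : ℤ) : ℝ))
    (fun x : ZMod p => ((quadraticChar (ZMod p) (x * n' + c) : ℤ) : ℝ))
    (fun m : ℕ => ((quadraticChar (ZMod p) ((((m : ℤ) * n + c : ℤ)) : ZMod p) : ℤ) : ℝ))
    (fun m : ℕ => ((quadraticChar (ZMod p) ((((m : ℤ) * n' + c : ℤ)) : ZMod p) : ℤ) : ℝ))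
    (fun m => by simp only [Int.cast_add, Int.cast_mul, Int.cast_natCast])
    (fun m => by simp only [Int.cast_add, Int.cast_mul, Int.cast_natCast])
    (fun x => hχ1 _) (fun x => hχ1 _) (hχ0 _ hn0) (hχ0 _ hn0') hJ M j hj hpj

end Summit.Parity.GeneralizedHardyLittlewood.Theorems.CosetDecorrelation.FareyLevelMeanCoupling
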